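/-
Origin: expansion seat `planner-pub-hodgecm-pv02-g8-0`, handover #1 2026-08-18T14:38:19Z (md5 6dd909789d779d9b4d26c741457226a7, 584 l., 61 decls; NEW additive KERNEL leaf; imports are ALL tree names after RUN 30: HodgeCM.Automorphic.WeilThetaModelDerivCentral (pv02-g7 r30 54a49e44), HodgeCM.Automorphic.KernelModelHeisenbergDeriv (pv02-g7 r30 ee3b0ae4), HodgeCM.Automorphic.SchrodingerSmoothVectors (pv14-g6 r30 8c024b22), Mathlib.Topology.Algebra.Module.FiniteDim (`HOME/pub-hodgecm-pv02-g8/lean/Pv02g8/WeilThetaModelDerivCalculus.lean`, md5 6dd90978, 584 lines);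
landed by the gen-8 packager in gate run 31 as `HodgeCM/Automorphic/WeilThetaModelDerivCalculus.lean` (verbatim).
-/
import Summits.HodgeConjecture.HodgeCM.Automorphic.WeilThetaModelDerivCentral
import Summits.HodgeConjecture.HodgeCM.Automorphic.KernelModelHeisenbergDeriv
import Summits.HodgeConjecture.HodgeCM.Automorphic.SchrodingerSmoothVectors
import Mathlib.Topology.Algebra.Module.FiniteDimension

/-!
# Calculus of `SK`-derivatives in a linear Weil theta model

KERNEL leaf (pv02 lane (A): linear structure + Weil-topology derivatives of Weil theta models), additive on top of
pv02-g7's `WeilThetaModelDeriv` (r30: `HasSKDerivAt`, transport under `ω(h)` and under continuous linear maps) and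
`WeilThetaModelDerivCentral` (r30: scalar curves).  Everything here is proved for an ABSTRACT linear Weil theta model
`M` (`M.LinearStr`) whose function space `S(X_A) = M.W.SX` is a topological vector space
(`[ContinuousAdd M.W.SX] [ContinuousSMul ℂ M.W.SX]`; for the constructed Schrödinger / Heisenberg / centre models
`S(X_A) = 𝓢(V, ℂ)` and these are Mathlib instances, §6), and uses of the model ONLY Weil's joint continuity of the
action, [We64] n° 39 (the field `actionContinuous`), through `ω(h) = s(1, h)`.

## Contents

* §1 `𝒮^κ = M.SK` is a topological vector space (instances `ContinuousAdd`, `ContinuousSMul ℂ`, `ContinuousSMul ℝ`,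
  `ContinuousNeg`, `IsTopologicalAddGroup` on `M.SK`), and **joint continuity of `(h, Φ) ↦ ω(h)Φ` on `G × 𝒮^κ`**
  (`continuous_omg_uncurry`, n° 39 along the continuous splitting).
* §2 Linearity of `HasSKDerivAt`: `add`, `const_smul`, `neg`, `sub`, `sum`, the scalar Leibniz rule `smul`
  (`(c • γ)' = c(s₀) • γ' + c' • γ(s₀)`), uniqueness of the derivative (`T2`), `congr`.
* §3 **Chain rule** (reparametrisation by a differentiable real function, `HasSKDerivAt.comp_hasDerivAt`:
  `(γ ∘ u)'(s₀) = u'(s₀) • γ'(u s₀)`), via the Carathéodory form of `HasSKDerivAt`; shifts and rescalings.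
* §4 **Leibniz rule for the Weil action** (`HasSKDerivAt.omg_family`): if `g : ℝ → G` is continuous at `s₀`, `γ` has
  `SK`-derivative `γ'` at `s₀`, and the orbit map `s ↦ ω(g s)(γ s₀)` of the FIXED vector `γ s₀` has `SK`-derivative
  `δ`, then `s ↦ ω(g s)(γ s)` has `SK`-derivative `ω(g s₀)γ' + δ`.  Corollaries: products of one-parameter families
  (`hasSKDerivAt_omg_mul`, generator additivity `d/ds|₀ ω(e₁(s)e₂(s))Φ = X₁Φ + X₂Φ` WITHOUT any
  Baker–Campbell–Hausdorff input), conjugates `w e(s) w⁻¹`.  This is the tool that assembles differentiability along a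
  one-parameter subgroup written as a product of factors each of which is separately understood (Bruhat / `NAK`-type
  factorisations `exp(sX) = n(u(s)) a(r(s)) w n(v(s)) w⁻¹`, with §3 for the reparametrisations `u, r, v`).
* §5 **The finite-dimensional principle**: a curve inside a finite-dimensional subspace `V ⊆ 𝒮^κ` is
  `SK`-differentiable as soon as it is differentiable after ANY linear observation `A : 𝒮^κ →ₗ[ℂ] E` injective on `V`
  (`E` any Hausdorff topological vector space, e.g. an `L²`-space, finitely many coefficient functionals, point
  evaluations): `hasSKDerivAt_of_finiteDimensional`, `hasSKDerivAt_of_injOn`, `hasSKDerivAt_of_linearIndependent`.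
  Mechanism: on a finite-dimensional Hausdorff ℂ-vector space all vector topologies agree
  (`LinearMap.continuous_of_finiteDimensional`).  USE: `K`-finite vectors (weight vectors of a compact torus / of
  `U(2)`-type factors) move inside finite-dimensional invariant subspaces, where pv05's `L²`-level derivatives
  (`hasDerivAt_fockRep_expUnitary_zero`, …) therefore ARE Weil-topology derivatives.  HONEST LABEL: the principle says
  nothing about non-compact directions (`𝔭'`-ladder directions at the `Σ₁₂` places), whose orbits leave every
  finite-dimensional subspace; those need §4 + Schwartz-space analysis (pv14 lineage).
* §6 The constructed models: the TVS instances for `schrodingerModel(Bot)`, `heisenbergModel(OverLattice, Std)`,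
  `centerModel`; and in pv15's centre–Heisenberg KERNEL model (`G = Heis V` acting by `ρ_m`): `ω` is multiplicative
  (`centerModel_omg_mul`), every Schwartz vector is differentiable along `γ_{a,b,c}` at EVERY `s₀`
  (`hasSKDerivAt_centerModel_expCurve_at`), and — the Leibniz rule at work on a genuinely non-commutative group —
  along the product of two one-parameter subgroups `s ↦ γ₁(s)γ₂(s)` (not a one-parameter subgroup when
  `[X₁, X₂] ≠ 0`) with derivative `dρ_m(X₁)Φ + dρ_m(X₂)Φ` (`hasSKDerivAt_centerModel_expCurve_mul`).

PRINT inputs: none beyond those of the imported modules ([We64] n° 39 via the model field).  Zero unproved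
declarations, no new axioms; every theorem is KERNEL (structural / Mathlib analysis).

References: [We64] A. Weil, Sur certains groupes d'opérateurs unitaires, Acta Math. 111 (1964), n° 39 p. 189;
[Fo89] G. B. Folland, Harmonic analysis in phase space (1989), Prop. (4.45) (the `L²` differentiability statement
that §5 upgrades to the Schwartz / Weil topology on finite-dimensional invariant subspaces).
-/

noncomputable section

open Filter Topology
open scoped SchwartzMap

namespace HodgeCM
namespace WeilThetaModel

variable {GU : Type} [Group GU] [TopologicalSpace GU] {ΓU : Subgroup GU}
variable {G : Type} [Group G] [TopologicalSpace G] {Γ : Subgroup G}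

/-! ## §1  `𝒮^κ` as a topological vector space; joint continuity of `ω` -/

section Joint

variable (M : WeilThetaModel GU ΓU G Γ)

/-- **Joint continuity of the Weil action on `𝒮^κ`**: `(h, Φ) ↦ ω(h)Φ` is continuous on `G × 𝒮^κ` — [We64] n° 39
(`actionContinuous`) composed with the continuous splitting `h ↦ s(1, h)` (`s_cont`), in the subspace topology. -/
theorem continuous_omg_uncurry : Continuous fun p : G × M.SK => M.omg p.1 p.2 := by
  have hact : Continuous (Function.uncurry M.W.act) := M.actionContinuous
  have h₁ : Continuous fun p : G × M.SK => M.W.act (M.s (1, p.1)) p.2.1 :=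
    hact.comp ((M.s_cont.comp (continuous_const.prodMk continuous_fst)).prodMk
      (continuous_subtype_val.comp continuous_snd))
  exact continuous_induced_rng.2 h₁

/-- Joint continuity in filter form: if `g → h₀` in `G` and `Φ → Φ₀` in `𝒮^κ` along a filter `l`, then
`ω(g)Φ → ω(h₀)Φ₀` along `l`. -/
theorem tendsto_omg_of_tendsto {α : Type*} {l : Filter α} {g : α → G} {h₀ : G} {Φ : α → M.SK} {Φ₀ : M.SK}
    (hg : Tendsto g l (𝓝 h₀)) (hΦ : Tendsto Φ l (𝓝 Φ₀)) :
    Tendsto (fun x => M.omg (g x) (Φ x)) l (𝓝 (M.omg h₀ Φ₀)) :=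
  ((M.continuous_omg_uncurry.tendsto (h₀, Φ₀)).comp (hg.prodMk_nhds hΦ))

end Joint

section TVS

variable (M : WeilThetaModel GU ΓU G Γ) [M.LinearStr]

/-- `𝒮^κ ⊆ S(X_A)` has continuous addition when `S(X_A)` has. -/
instance continuousAdd_SK [ContinuousAdd M.W.SX] : ContinuousAdd M.SK :=
  ⟨continuous_induced_rng.2
    ((continuous_subtype_val.comp continuous_fst).add (continuous_subtype_val.comp continuous_snd))⟩

/-- `𝒮^κ ⊆ S(X_A)` has continuous scalar multiplication when `S(X_A)` has. -/
instance continuousSMul_SK [ContinuousSMul ℂ M.W.SX] : ContinuousSMul ℂ M.SK :=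
  ⟨continuous_induced_rng.2 (continuous_fst.smul (continuous_subtype_val.comp continuous_snd))⟩

/-- … hence continuous real scalar multiplication (the real action is the restriction of the complex one). -/
instance continuousSMul_real_SK [ContinuousSMul ℂ M.W.SX] : ContinuousSMul ℝ M.SK :=
  IsScalarTower.continuousSMul ℂ

/-- … hence continuous negation (`-Φ = (-1) • Φ`). -/
instance continuousNeg_SK [ContinuousSMul ℂ M.W.SX] : ContinuousNeg M.SK := by
  refine ⟨?_⟩
  have h : (fun Φ : M.SK => -Φ) = fun Φ : M.SK => (-1 : ℂ) • Φ := funext fun Φ => (neg_one_smul ℂ Φ).symm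
  rw [h]
  exact continuous_id.const_smul (-1 : ℂ)

/-- … hence `𝒮^κ` is a topological additive group, i.e. (with `continuousSMul_SK`) a topological vector space. -/
instance isTopologicalAddGroup_SK [ContinuousAdd M.W.SX] [ContinuousSMul ℂ M.W.SX] :
    IsTopologicalAddGroup M.SK := ⟨⟩

/-- The inclusion `𝒮^κ →ₗ S(X_A)` is continuous (it is the subtype embedding). -/
theorem SKvalₗ_continuous : Continuous M.SKvalₗ := continuous_subtype_val

end TVS

variable {M : WeilThetaModel GU ΓU G Γ} [M.LinearStr]

/-! ## §2  Linearity of `HasSKDerivAt`, scalar Leibniz rule, uniqueness -/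

/-- The real difference quotient of an `𝒮^κ`-valued curve is the complex one with coerced scalar. -/
theorem slope_eq_coe_smul (γ : ℝ → M.SK) (s₀ s : ℝ) :
    slope γ s₀ s = (((s - s₀)⁻¹ : ℝ) : ℂ) • (γ s - γ s₀) := by
  rw [slope_def_module, Complex.coe_smul]

/-- `HasSKDerivAt` is invariant under pointwise-equal curves … -/
theorem HasSKDerivAt.congr {γ₁ γ₂ : ℝ → M.SK} {γ' : M.SK} {s₀ : ℝ} (h : M.HasSKDerivAt γ₁ γ' s₀)
    (heq : ∀ s, γ₂ s = γ₁ s) : M.HasSKDerivAt γ₂ γ' s₀ := by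
  have : γ₂ = γ₁ := funext heq
  rw [this]; exact h

/-- … and under rewriting the derivative. -/
theorem HasSKDerivAt.congr_deriv {γ : ℝ → M.SK} {γ' γ'' : M.SK} {s₀ : ℝ} (h : M.HasSKDerivAt γ γ' s₀)
    (heq : γ'' = γ') : M.HasSKDerivAt γ γ'' s₀ := heq ▸ h

/-- `HasSKDerivAt` only depends on the germ of the curve at `s₀`. -/
theorem HasSKDerivAt.congr_of_eventuallyEq {γ₁ γ₂ : ℝ → M.SK} {γ' : M.SK} {s₀ : ℝ}
    (h : M.HasSKDerivAt γ₁ γ' s₀) (heq : γ₂ =ᶠ[𝓝 s₀] γ₁) : M.HasSKDerivAt γ₂ γ' s₀ := by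
  have h0 : γ₂ s₀ = γ₁ s₀ := heq.eq_of_nhds
  refine Filter.Tendsto.congr' ?_ h
  filter_upwards [mem_nhdsWithin_of_mem_nhds heq] with s hs
  rw [slope_def_module, slope_def_module, hs, h0]

/-- **Uniqueness of the `SK`-derivative** (for Hausdorff `S(X_A)`): `dω(X)Φ` is well defined. -/
theorem HasSKDerivAt.unique [T2Space M.W.SX] {γ : ℝ → M.SK} {γ'₁ γ'₂ : M.SK} {s₀ : ℝ}
    (h₁ : M.HasSKDerivAt γ γ'₁ s₀) (h₂ : M.HasSKDerivAt γ γ'₂ s₀) : γ'₁ = γ'₂ :=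
  tendsto_nhds_unique h₁ h₂

/-- Sum rule. -/
theorem HasSKDerivAt.add [ContinuousAdd M.W.SX] {γ₁ γ₂ : ℝ → M.SK} {γ₁' γ₂' : M.SK} {s₀ : ℝ}
    (h₁ : M.HasSKDerivAt γ₁ γ₁' s₀) (h₂ : M.HasSKDerivAt γ₂ γ₂' s₀) :
    M.HasSKDerivAt (fun s => γ₁ s + γ₂ s) (γ₁' + γ₂') s₀ := by
  have key : slope (fun s => γ₁ s + γ₂ s) s₀ = fun s => slope γ₁ s₀ s + slope γ₂ s₀ s := by
    funext s
    rw [slope_def_module, slope_def_module, slope_def_module, ← smul_add, add_sub_add_comm]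
  unfold HasSKDerivAt
  rw [key]
  exact Filter.Tendsto.add h₁ h₂

/-- Constant multiples. -/
theorem HasSKDerivAt.const_smul [ContinuousSMul ℂ M.W.SX] {γ : ℝ → M.SK} {γ' : M.SK} {s₀ : ℝ}
    (h : M.HasSKDerivAt γ γ' s₀) (a : ℂ) : M.HasSKDerivAt (fun s => a • γ s) (a • γ') s₀ := by
  have key : slope (fun s => a • γ s) s₀ = fun s => a • slope γ s₀ s := by
    funext s
    rw [slope_def_module, slope_def_module, ← smul_sub, ← Complex.coe_smul, ← Complex.coe_smul, smul_smul,
      smul_smul, mul_comm]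
  unfold HasSKDerivAt
  rw [key]
  exact Filter.Tendsto.const_smul h a

/-- Negatives. -/
theorem HasSKDerivAt.neg [ContinuousSMul ℂ M.W.SX] {γ : ℝ → M.SK} {γ' : M.SK} {s₀ : ℝ}
    (h : M.HasSKDerivAt γ γ' s₀) : M.HasSKDerivAt (fun s => -γ s) (-γ') s₀ := by
  simpa only [neg_one_smul] using h.const_smul (-1)

/-- Difference rule. -/
theorem HasSKDerivAt.sub [ContinuousAdd M.W.SX] [ContinuousSMul ℂ M.W.SX] {γ₁ γ₂ : ℝ → M.SK}
    {γ₁' γ₂' : M.SK} {s₀ : ℝ} (h₁ : M.HasSKDerivAt γ₁ γ₁' s₀) (h₂ : M.HasSKDerivAt γ₂ γ₂' s₀) :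
    M.HasSKDerivAt (fun s => γ₁ s - γ₂ s) (γ₁' - γ₂') s₀ := by
  simpa only [sub_eq_add_neg] using h₁.add h₂.neg

/-- Finite sums. -/
theorem HasSKDerivAt.sum [ContinuousAdd M.W.SX] {ι : Type*} (t : Finset ι) {γ : ι → ℝ → M.SK}
    {γ' : ι → M.SK} {s₀ : ℝ} (h : ∀ i ∈ t, M.HasSKDerivAt (γ i) (γ' i) s₀) :
    M.HasSKDerivAt (fun s => ∑ i ∈ t, γ i s) (∑ i ∈ t, γ' i) s₀ := by
  classical
  induction t using Finset.induction_on with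
  | empty => simpa using hasSKDerivAt_const (M := M) 0 s₀
  | insert a t ha ih =>
    have h' := (h a (Finset.mem_insert_self a t)).add (ih fun i hi => h i (Finset.mem_insert_of_mem hi))
    simpa only [Finset.sum_insert ha] using h'

/-- Scalar curves, with the continuity hypothesis of `hasSKDerivAt_smul_const` discharged by the TVS structure. -/
theorem hasSKDerivAt_smul_const' [ContinuousSMul ℂ M.W.SX] {c : ℝ → ℂ} {c' : ℂ} {s₀ : ℝ}
    (hc : HasDerivAt c c' s₀) (Φ : M.SK) : M.HasSKDerivAt (fun s => c s • Φ) (c' • Φ) s₀ :=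
  hasSKDerivAt_smul_const hc Φ (continuous_id.smul continuous_const)

/-- Finite linear combinations with differentiable coefficients: `s ↦ ∑ᵢ cᵢ(s) • Φᵢ` has `SK`-derivative
`∑ᵢ cᵢ'(s₀) • Φᵢ` — every curve in a finite-dimensional subspace given in coordinates. -/
theorem hasSKDerivAt_sum_smul_const [ContinuousAdd M.W.SX] [ContinuousSMul ℂ M.W.SX] {ι : Type*} (t : Finset ι)
    {c : ι → ℝ → ℂ} {c' : ι → ℂ} {s₀ : ℝ} (hc : ∀ i ∈ t, HasDerivAt (c i) (c' i) s₀) (Φ : ι → M.SK) :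
    M.HasSKDerivAt (fun s => ∑ i ∈ t, c i s • Φ i) (∑ i ∈ t, c' i • Φ i) s₀ :=
  HasSKDerivAt.sum t fun i hi => hasSKDerivAt_smul_const' (hc i hi) (Φ i)

/-- **Scalar Leibniz rule**: `(c • γ)'(s₀) = c(s₀) • γ'(s₀) + c'(s₀) • γ(s₀)`. -/
theorem HasSKDerivAt.smul [ContinuousAdd M.W.SX] [ContinuousSMul ℂ M.W.SX] {c : ℝ → ℂ} {c' : ℂ}
    {γ : ℝ → M.SK} {γ' : M.SK} {s₀ : ℝ} (hc : HasDerivAt c c' s₀) (hγ : M.HasSKDerivAt γ γ' s₀) :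
    M.HasSKDerivAt (fun s => c s • γ s) (c s₀ • γ' + c' • γ s₀) s₀ := by
  have key : slope (fun s => c s • γ s) s₀ = fun s => c s • slope γ s₀ s + slope c s₀ s • γ s₀ := by
    funext s
    rw [slope_def_module, slope_def_module, slope_def_module, Complex.real_smul, ← Complex.coe_smul,
      ← Complex.coe_smul]
    module
  have hcs : Tendsto c (𝓝[≠] s₀) (𝓝 (c s₀)) := hc.continuousAt.tendsto.mono_left nhdsWithin_le_nhds
  have hcs' : Tendsto (slope c s₀) (𝓝[≠] s₀) (𝓝 c') := hasDerivAt_iff_tendsto_slope.mp hc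
  unfold HasSKDerivAt
  rw [key]
  exact (hcs.smul hγ).add (hcs'.smul tendsto_const_nhds)

/-! ## §3  Chain rule: reparametrisation by a differentiable real function -/

/-- **Carathéodory form** of `HasSKDerivAt`: `γ t - γ t₀ = (t - t₀) • ψ t` with `ψ` continuous at `t₀`, `ψ t₀ = γ'`
(`ψ` = the slope function patched at `t₀`). -/
theorem HasSKDerivAt.exists_caratheodory {γ : ℝ → M.SK} {γ' : M.SK} {t₀ : ℝ} (h : M.HasSKDerivAt γ γ' t₀) :
    ∃ ψ : ℝ → M.SK, ContinuousAt ψ t₀ ∧ ψ t₀ = γ' ∧ ∀ t, γ t - γ t₀ = (t - t₀) • ψ t := by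
  classical
  refine ⟨Function.update (slope γ t₀) t₀ γ', continuousAt_update_same.2 h, Function.update_self _ _ _, ?_⟩
  intro t
  by_cases ht : t = t₀
  · subst ht; simp
  · rw [Function.update_of_ne ht, sub_smul_slope, vsub_eq_sub]

/-- An `SK`-differentiable curve is continuous at the point (in Weil's topology). -/
theorem HasSKDerivAt.continuousAt [ContinuousAdd M.W.SX] [ContinuousSMul ℂ M.W.SX] {γ : ℝ → M.SK} {γ' : M.SK}
    {t₀ : ℝ} (h : M.HasSKDerivAt γ γ' t₀) : ContinuousAt γ t₀ := by
  obtain ⟨ψ, hψ, -, hγψ⟩ := h.exists_caratheodory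
  have h1 : Tendsto (fun t : ℝ => t - t₀) (𝓝 t₀) (𝓝 0) := by
    simpa using (tendsto_id.sub tendsto_const_nhds : Tendsto (fun t : ℝ => t - t₀) (𝓝 t₀) (𝓝 (t₀ - t₀)))
  have h2 : Tendsto (fun t => γ t₀ + (t - t₀) • ψ t) (𝓝 t₀) (𝓝 (γ t₀ + (0 : ℝ) • ψ t₀)) :=
    tendsto_const_nhds.add (h1.smul hψ.tendsto)
  rw [zero_smul, add_zero] at h2
  refine Filter.Tendsto.congr (fun t => ?_) h2
  rw [← hγψ t, add_sub_cancel]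

/-- **Chain rule**: if `γ` has `SK`-derivative `γ'` at `u s₀` and `u : ℝ → ℝ` has derivative `u'` at `s₀`, then
`γ ∘ u` has `SK`-derivative `u' • γ'` at `s₀`. -/
theorem HasSKDerivAt.comp_hasDerivAt [ContinuousSMul ℂ M.W.SX] {γ : ℝ → M.SK} {γ' : M.SK} {u : ℝ → ℝ}
    {u' s₀ : ℝ} (hγ : M.HasSKDerivAt γ γ' (u s₀)) (hu : HasDerivAt u u' s₀) :
    M.HasSKDerivAt (fun s => γ (u s)) (u' • γ') s₀ := by
  obtain ⟨ψ, hψ, hψ₀, hγψ⟩ := hγ.exists_caratheodory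
  have key : slope (fun s => γ (u s)) s₀ = fun s => slope u s₀ s • ψ (u s) := by
    funext s
    rw [slope_def_module, slope_def_module, hγψ (u s), smul_smul, smul_eq_mul]
  have hus : Tendsto u (𝓝[≠] s₀) (𝓝 (u s₀)) := hu.continuousAt.tendsto.mono_left nhdsWithin_le_nhds
  have hψu : Tendsto (fun s => ψ (u s)) (𝓝[≠] s₀) (𝓝 γ') := by
    rw [← hψ₀]; exact hψ.tendsto.comp hus
  unfold HasSKDerivAt
  rw [key]
  exact (hasDerivAt_iff_tendsto_slope.mp hu).smul hψu

/-- Shift of the parameter: `s ↦ γ (a + s)`. -/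
theorem HasSKDerivAt.comp_const_add [ContinuousSMul ℂ M.W.SX] {γ : ℝ → M.SK} {γ' : M.SK} (a : ℝ) {s₀ : ℝ}
    (hγ : M.HasSKDerivAt γ γ' (a + s₀)) : M.HasSKDerivAt (fun s => γ (a + s)) γ' s₀ := by
  simpa only [one_smul] using hγ.comp_hasDerivAt ((hasDerivAt_id s₀).const_add a)

/-- Rescaling of the parameter: `s ↦ γ (a * s)` has `SK`-derivative `a • γ'`. -/
theorem HasSKDerivAt.comp_const_mul [ContinuousSMul ℂ M.W.SX] {γ : ℝ → M.SK} {γ' : M.SK} (a : ℝ) {s₀ : ℝ}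
    (hγ : M.HasSKDerivAt γ γ' (a * s₀)) : M.HasSKDerivAt (fun s => γ (a * s)) (a • γ') s₀ := by
  simpa only [mul_one] using hγ.comp_hasDerivAt ((hasDerivAt_id s₀).const_mul a)

/-! ## §4  Leibniz rule for the Weil action -/

/-- `ω(h)` commutes with real difference quotients. -/
theorem omg_slope (h : G) (γ : ℝ → M.SK) (s₀ s : ℝ) :
    M.omg h (slope γ s₀ s) = ((s - s₀)⁻¹ : ℝ) • (M.omg h (γ s) - M.omg h (γ s₀)) := by
  rw [slope_def_module, ← Complex.coe_smul, ← Complex.coe_smul, M.omg_smul, M.omg_sub]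

/-- **Leibniz rule for `ω` along a family of group elements.**  `g : ℝ → G` continuous at `s₀`; `γ` has
`SK`-derivative `γ'` at `s₀`; the orbit map `s ↦ ω(g s)(γ s₀)` of the FIXED vector `γ s₀` has `SK`-derivative `δ` at
`s₀`.  Then `s ↦ ω(g s)(γ s)` has `SK`-derivative `ω(g s₀)γ' + δ` at `s₀`.  (Joint continuity n° 39 controls the term
`ω(g s)(slope γ)`; no equicontinuity or local boundedness hypothesis is needed beyond it.) -/
theorem HasSKDerivAt.omg_family [ContinuousAdd M.W.SX] {g : ℝ → G} {s₀ : ℝ} (hg : ContinuousAt g s₀)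
    {γ : ℝ → M.SK} {γ' δ : M.SK} (hγ : M.HasSKDerivAt γ γ' s₀)
    (hδ : M.HasSKDerivAt (fun s => M.omg (g s) (γ s₀)) δ s₀) :
    M.HasSKDerivAt (fun s => M.omg (g s) (γ s)) (M.omg (g s₀) γ' + δ) s₀ := by
  have key : slope (fun s => M.omg (g s) (γ s)) s₀ =
      fun s => M.omg (g s) (slope γ s₀ s) + slope (fun s => M.omg (g s) (γ s₀)) s₀ s := by
    funext s
    rw [omg_slope, slope_def_module, slope_def_module, ← smul_add, sub_add_sub_cancel]
  have h₁ : Tendsto (fun s => M.omg (g s) (slope γ s₀ s)) (𝓝[≠] s₀) (𝓝 (M.omg (g s₀) γ')) :=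
    M.tendsto_omg_of_tendsto (hg.tendsto.mono_left nhdsWithin_le_nhds) hγ
  unfold HasSKDerivAt
  rw [key]
  exact h₁.add hδ

/-- **Products of one-parameter families.**  If `ω` is multiplicative on the elements concerned
(`ω(e₁(s) e₂(s))Φ = ω(e₁ s)(ω(e₂ s)Φ)` — a hypothesis: the abstract model records the action law only through `Θ`;
it holds in every constructed model, e.g. `centerModel_omg_mul`), `e₁` is continuous at `s₀`, `s ↦ ω(e₂ s)Φ` has
`SK`-derivative `X₂` at `s₀` and `s ↦ ω(e₁ s)(ω(e₂ s₀)Φ)` has `SK`-derivative `X₁` at `s₀`, then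
`s ↦ ω(e₁(s) e₂(s))Φ` has `SK`-derivative `ω(e₁ s₀) X₂ + X₁` at `s₀`. -/
theorem hasSKDerivAt_omg_mul [ContinuousAdd M.W.SX] {e₁ e₂ : ℝ → G} {s₀ : ℝ} (he₁ : ContinuousAt e₁ s₀)
    (Φ : M.SK) {X₁ X₂ : M.SK} (hmul : ∀ s, M.omg (e₁ s * e₂ s) Φ = M.omg (e₁ s) (M.omg (e₂ s) Φ))
    (h₂ : M.HasSKDerivAt (fun s => M.omg (e₂ s) Φ) X₂ s₀)
    (h₁ : M.HasSKDerivAt (fun s => M.omg (e₁ s) (M.omg (e₂ s₀) Φ)) X₁ s₀) :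
    M.HasSKDerivAt (fun s => M.omg (e₁ s * e₂ s) Φ) (M.omg (e₁ s₀) X₂ + X₁) s₀ :=
  (h₂.omg_family he₁ h₁).congr hmul

/-- **Generator additivity** (`d/ds|₀ ω(e₁(s) e₂(s))Φ = X₁Φ + X₂Φ`): at a parameter where both families pass through
the identity, the derivative along the product family is the SUM of the two derivatives — no Baker–Campbell–Hausdorff
formula, no commutator estimate. -/
theorem hasSKDerivAt_omg_mul_of_eq_one [ContinuousAdd M.W.SX] {e₁ e₂ : ℝ → G} {s₀ : ℝ}
    (he₁ : ContinuousAt e₁ s₀) (h₁1 : e₁ s₀ = 1) (h₂1 : e₂ s₀ = 1) (Φ : M.SK) {X₁ X₂ : M.SK}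
    (hmul : ∀ s, M.omg (e₁ s * e₂ s) Φ = M.omg (e₁ s) (M.omg (e₂ s) Φ))
    (h₁ : M.HasSKDerivAt (fun s => M.omg (e₁ s) Φ) X₁ s₀) (h₂ : M.HasSKDerivAt (fun s => M.omg (e₂ s) Φ) X₂ s₀) :
    M.HasSKDerivAt (fun s => M.omg (e₁ s * e₂ s) Φ) (X₁ + X₂) s₀ := by
  have h₁' : M.HasSKDerivAt (fun s => M.omg (e₁ s) (M.omg (e₂ s₀) Φ)) X₁ s₀ := by
    simpa only [h₂1, M.omg_one] using h₁
  have h := hasSKDerivAt_omg_mul he₁ Φ hmul h₂ h₁'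
  rw [h₁1, M.omg_one, add_comm] at h
  exact h

/-- **Conjugate families** `s ↦ w e(s) w⁻¹`: derivative `ω(w) X` where `X` is the derivative of `s ↦ ω(e s)(ω(w⁻¹)Φ)`
(multiplicativity of `ω` on the elements concerned as a hypothesis, as above). -/
theorem hasSKDerivAt_omg_conj {w : G} {e : ℝ → G} {Φ X : M.SK} {s₀ : ℝ}
    (hmul : ∀ s, M.omg (w * e s * w⁻¹) Φ = M.omg w (M.omg (e s) (M.omg w⁻¹ Φ)))
    (h : M.HasSKDerivAt (fun s => M.omg (e s) (M.omg w⁻¹ Φ)) X s₀) :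
    M.HasSKDerivAt (fun s => M.omg (w * e s * w⁻¹) Φ) (M.omg w X) s₀ :=
  (h.omg w).congr hmul

/-! ## §5  The finite-dimensional principle -/

section FiniteDimensional

variable [ContinuousAdd M.W.SX] [ContinuousSMul ℂ M.W.SX]

/-- **Curves through a finite-dimensional space are `SK`-differentiable.**  `F` a finite-dimensional Hausdorff
topological ℂ-vector space, `ι : F →ₗ[ℂ] 𝒮^κ` ANY linear map (automatically continuous:
`LinearMap.continuous_of_finiteDimensional`), `c : ℝ → F` with convergent difference quotients at `s₀`.  Then
`ι ∘ c` has `SK`-derivative `ι c'` — in Weil's topology, whatever it is. -/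
theorem hasSKDerivAt_of_finiteDimensional {F : Type*} [AddCommGroup F] [Module ℂ F] [TopologicalSpace F]
    [IsTopologicalAddGroup F] [ContinuousSMul ℂ F] [T2Space F] [FiniteDimensional ℂ F]
    (ι : F →ₗ[ℂ] M.SK) {c : ℝ → F} {c' : F} {s₀ : ℝ} (hc : Tendsto (slope c s₀) (𝓝[≠] s₀) (𝓝 c')) :
    M.HasSKDerivAt (fun s => ι (c s)) (ι c') s₀ :=
  tendsto_slope_comp_of_tendsto_slope ι ι.continuous_of_finiteDimensional hc

/-- The same for a normed finite-dimensional `F` and `HasDerivAt`. -/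
theorem hasSKDerivAt_of_hasDerivAt_finiteDimensional {F : Type*} [NormedAddCommGroup F] [NormedSpace ℂ F]
    [FiniteDimensional ℂ F] (ι : F →ₗ[ℂ] M.SK) {c : ℝ → F} {c' : F} {s₀ : ℝ} (hc : HasDerivAt c c' s₀) :
    M.HasSKDerivAt (fun s => ι (c s)) (ι c') s₀ :=
  hasSKDerivAt_of_finiteDimensional ι (hasDerivAt_iff_tendsto_slope.mp hc)

/-- Difference quotients of a curve in a submodule, read in the ambient space. -/
theorem tendsto_slope_submodule_iff {E : Type*} [AddCommGroup E] [Module ℂ E] [TopologicalSpace E]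
    (R : Submodule ℂ E) {d : ℝ → R} {d' : R} {s₀ : ℝ} :
    Tendsto (slope d s₀) (𝓝[≠] s₀) (𝓝 d') ↔
      Tendsto (slope (fun s => (d s : E)) s₀) (𝓝[≠] s₀) (𝓝 (d' : E)) := by
  have h : slope (fun s => (d s : E)) s₀ = fun s => ((slope d s₀ s : R) : E) := by
    funext s
    rw [slope_def_module, slope_def_module, ← Complex.coe_smul, ← Complex.coe_smul, Submodule.coe_smul,
      Submodule.coe_sub]
  rw [h, Topology.IsInducing.subtypeVal.tendsto_nhds_iff]
  rfl


-- port_pkg: scope closed for this part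
end FiniteDimensional
end WeilThetaModel
end HodgeCM
end
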